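import Mathlib

/-!
# `MatrixDescartes` census — DOOR A at `(3,4)`: DEFINITE-END-LETTER laws for three-letter pencils (all supports)

HONEST FRAMING.  Object-search cell `pub-symmetroid`, door-A seat `val-sym-door-p3` (g7); item stmt-ValiantsHypothesis-19980
`DoorA34 = PosRootLawAt 3 4 18` is OPEN and asserted nowhere in this file.  After the FLAG LAW
(`Census.flagLaw_no_five_one`, seat g6) the cell's graft mechanism for a `(3,4)` nineteen needs a `(3,3)` source row
`F(x) = x^{d₀} S₀ + x^{d₁} S₁ + x^{d₂} S₂` with a DEFINITE END LETTER all of whose nine roots are definite-edge roots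
(a `λ₁`-oscillator).  This file records, for ALL sorted supports `d₀ < d₁ < d₂`, any matrix size `m` and with no
hypothesis beyond one definite direction of the end letter, the two elementary laws that organise that question
(seat report DOOR-A34-P3G7 §2):

* `endLetter_ray_law` — **RAY LAW.**  If `uᵀ S₀ u > 0`, `uᵀ S₂ u ≤ 0` and `uᵀ F(r) u ≤ 0` at some `r > 0` (e.g. `u` a kernel
  vector of a det-root `r`), then `uᵀ F(x) u < 0` for EVERY `x > r`: `F(x)` is positive semidefinite at no `x > r`
  (`endLetter_not_posSemidef_beyond`).  So along a definite-bottom-letter row at most ONE positive-semidefinite det-root has a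
  kernel vector with `uᵀ S₂ u ≤ 0`, and it is the last one; `endLetter_ray_law_below` is the mirror law for a definite TOP letter.
* `endLetter_interval_law` — **INTERVAL LAW.**  If `uᵀ S₀ u > 0` and `uᵀ F(x₁) u ≤ 0`, `uᵀ F(x₃) u ≤ 0` at `0 < x₁ < x₃`, then
  `uᵀ F(x₂) u < 0` for every `x₂ ∈ (x₁, x₃)`: the set where a fixed direction is non-positive is an INTERVAL (the trinomial
  `uᵀ F(x) u / x^{d₁}` is strictly convex or strictly decreasing).  Hence one direction never witnesses two distinct non-definite
  gaps of a definite-end-letter row (`endLetter_not_posSemidef_between`), and the kernel vector of a det-root is strictly positive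
  at every det-root beyond the next positive definite point (`endLetter_kernel_pos_beyond_gap`) — the `1 × 1` companion of the
  plane law `Census.witnessed_gaps_le_four` (seat g5), sharper because a line compression of a three-letter row is a trinomial.

Scalar cores: `trinomial_ray_law`, `trinomial_ray_law_below`, `trinomial_interval_law`.  Nothing here bounds `ζ_sym(3,4)` or
`ζ_sym(3,3)`; `DoorA34` stays OPEN; nothing bears on `MatrixDescartes` (stmt-ValiantsHypothesis-18050) or `VP ≠ VNP`.

[folklore] monotonicity and convexity of real powers (Mathlib `strictConvexOn_zpow`, `convexOn_zpow`); elementary.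
-/

-- `Summit.ValiantsHypothesis.ValiantsHypothesis.…` repeats a component by the D-0017 layout
-- (single-conjunct summit), which the `dupNamespace` linter flags; the name is mandated.
set_option linter.dupNamespace false

namespace Summit.ValiantsHypothesis.ValiantsHypothesis.Theorems.LacunarySymmetroidMatrixDescartes.Census

open Finset Matrix Set
open scoped BigOperators Matrix

/-! ## Scalar trinomial laws -/

/-- **Ray law for a trinomial** `q(y) = α y^a + β y^{a+p} + γ y^{a+p+n}` with `α > 0`, `γ ≤ 0`, `p ≥ 1`:
`q(r) ≤ 0` at some `r > 0` forces `q(x) < 0` for every `x > r` (`q(y)/y^{a+p}` is strictly decreasing). [folklore] -/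
theorem trinomial_ray_law {a p n : ℕ} (hp : 0 < p) {α β γ r x : ℝ} (hα : 0 < α) (hγ : γ ≤ 0)
    (hr : 0 < r) (hrx : r < x)
    (hqr : α * r ^ a + β * r ^ (a + p) + γ * r ^ (a + p + n) ≤ 0) :
    α * x ^ a + β * x ^ (a + p) + γ * x ^ (a + p + n) < 0 := by
  have hx : 0 < x := hr.trans hrx
  have hpow : r ^ p < x ^ p := pow_lt_pow_left₀ hrx hr.le hp.ne'
  have hpown : r ^ n ≤ x ^ n := pow_le_pow_left₀ hr.le hrx.le n
  have key : (α * x ^ a + β * x ^ (a + p) + γ * x ^ (a + p + n)) * r ^ (a + p)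
      = (α * r ^ a + β * r ^ (a + p) + γ * r ^ (a + p + n)) * x ^ (a + p)
        + α * (x ^ a * r ^ a) * (r ^ p - x ^ p) + γ * ((x ^ (a + p) * r ^ (a + p)) * (x ^ n - r ^ n)) := by
    ring
  have hxa : 0 < x ^ a * r ^ a := by positivity
  have h1 : α * (x ^ a * r ^ a) * (r ^ p - x ^ p) < 0 := by
    have : 0 < α * (x ^ a * r ^ a) := mul_pos hα hxa
    exact mul_neg_of_pos_of_neg this (by linarith)
  have h2 : γ * ((x ^ (a + p) * r ^ (a + p)) * (x ^ n - r ^ n)) ≤ 0 := by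
    have : 0 ≤ (x ^ (a + p) * r ^ (a + p)) * (x ^ n - r ^ n) :=
      mul_nonneg (by positivity) (by linarith)
    exact mul_nonpos_of_nonpos_of_nonneg hγ this
  have hxb : 0 < x ^ (a + p) := by positivity
  have hrb : 0 < r ^ (a + p) := by positivity
  have h0 : (α * r ^ a + β * r ^ (a + p) + γ * r ^ (a + p + n)) * x ^ (a + p) ≤ 0 :=
    mul_nonpos_of_nonpos_of_nonneg hqr hxb.le
  have hlt : (α * x ^ a + β * x ^ (a + p) + γ * x ^ (a + p + n)) * r ^ (a + p) < 0 := by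
    rw [key]; linarith
  by_contra hcon
  have := mul_nonneg (not_lt.mp hcon) hrb.le
  linarith

/-- **Ray law below** (mirror of `trinomial_ray_law`): `q(y) = α y^a + β y^{a+p} + γ y^{a+p+n}` with `α ≤ 0`, `γ > 0`,
`n ≥ 1`: `q(r) ≤ 0` at some `r > 0` forces `q(x) < 0` for every `0 < x < r`. [folklore] -/
theorem trinomial_ray_law_below {a p n : ℕ} (hn : 0 < n) {α β γ r x : ℝ} (hα : α ≤ 0) (hγ : 0 < γ)
    (hx : 0 < x) (hxr : x < r)
    (hqr : α * r ^ a + β * r ^ (a + p) + γ * r ^ (a + p + n) ≤ 0) :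
    α * x ^ a + β * x ^ (a + p) + γ * x ^ (a + p + n) < 0 := by
  have hr : 0 < r := hx.trans hxr
  have hpow : x ^ p ≤ r ^ p := pow_le_pow_left₀ hx.le hxr.le p
  have hpown : x ^ n < r ^ n := pow_lt_pow_left₀ hxr hx.le hn.ne'
  have key : (α * x ^ a + β * x ^ (a + p) + γ * x ^ (a + p + n)) * r ^ (a + p)
      = (α * r ^ a + β * r ^ (a + p) + γ * r ^ (a + p + n)) * x ^ (a + p)
        + α * ((x ^ a * r ^ a) * (r ^ p - x ^ p)) + γ * (x ^ (a + p) * r ^ (a + p)) * (x ^ n - r ^ n) := by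
    ring
  have h1 : α * ((x ^ a * r ^ a) * (r ^ p - x ^ p)) ≤ 0 := by
    have : 0 ≤ (x ^ a * r ^ a) * (r ^ p - x ^ p) := mul_nonneg (by positivity) (by linarith)
    exact mul_nonpos_of_nonpos_of_nonneg hα this
  have h2 : γ * (x ^ (a + p) * r ^ (a + p)) * (x ^ n - r ^ n) < 0 := by
    have : 0 < γ * (x ^ (a + p) * r ^ (a + p)) := mul_pos hγ (by positivity)
    exact mul_neg_of_pos_of_neg this (by linarith)
  have hxb : 0 < x ^ (a + p) := by positivity
  have hrb : 0 < r ^ (a + p) := by positivity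
  have h0 : (α * r ^ a + β * r ^ (a + p) + γ * r ^ (a + p + n)) * x ^ (a + p) ≤ 0 :=
    mul_nonpos_of_nonpos_of_nonneg hqr hxb.le
  have hlt : (α * x ^ a + β * x ^ (a + p) + γ * x ^ (a + p + n)) * r ^ (a + p) < 0 := by
    rw [key]; linarith
  by_contra hcon
  have := mul_nonneg (not_lt.mp hcon) hrb.le
  linarith

/-- **Interval law for a trinomial** `q(y) = α y^a + β y^{a+p} + γ y^{a+p+n}` with `α > 0`, `p ≥ 1` (any `β`, `γ`):
if `q(x₁) ≤ 0` and `q(x₃) ≤ 0` with `0 < x₁ < x₃` then `q(x₂) < 0` for every `x₂ ∈ (x₁, x₃)` — the non-positivity set of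
`q` on `(0, ∞)` is an interval (`q(y)/y^{a+p}` is strictly decreasing when `γ ≤ 0` and strictly convex when `γ > 0`). [folklore] -/
theorem trinomial_interval_law {a p n : ℕ} (hp : 0 < p) {α β γ x₁ x₂ x₃ : ℝ} (hα : 0 < α)
    (hx₁ : 0 < x₁) (h12 : x₁ < x₂) (h23 : x₂ < x₃)
    (hq1 : α * x₁ ^ a + β * x₁ ^ (a + p) + γ * x₁ ^ (a + p + n) ≤ 0)
    (hq3 : α * x₃ ^ a + β * x₃ ^ (a + p) + γ * x₃ ^ (a + p + n) ≤ 0) :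
    α * x₂ ^ a + β * x₂ ^ (a + p) + γ * x₂ ^ (a + p + n) < 0 := by
  rcases le_or_gt γ 0 with hγ | hγ
  · exact trinomial_ray_law hp hα hγ hx₁ h12 hq1
  -- `γ > 0`: strict convexity of `ψ(y) = y^{-p} + (γ/α) y^n + β/α` on `(0, ∞)`, and `q(y) = α y^{a+p} ψ(y)`
  have hx₂ : 0 < x₂ := hx₁.trans h12
  have hx₃ : 0 < x₃ := hx₂.trans h23
  set ψ : ℝ → ℝ := fun y => y ^ (-(p : ℤ)) + ((γ / α) • y ^ (n : ℤ) + β / α) with hψ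
  have hconv : StrictConvexOn ℝ (Ioi (0 : ℝ)) ψ := by
    have h1 : StrictConvexOn ℝ (Ioi (0 : ℝ)) (fun y : ℝ => y ^ (-(p : ℤ))) :=
      strictConvexOn_zpow (by omega) (by omega)
    have h2 : ConvexOn ℝ (Ioi (0 : ℝ)) (fun y : ℝ => (γ / α) • y ^ (n : ℤ) + β / α) :=
      ((convexOn_zpow (n : ℤ)).smul (div_nonneg hγ.le hα.le)).add_const _
    exact h1.add_convexOn h2
  have hfac : ∀ y : ℝ, 0 < y →
      α * y ^ a + β * y ^ (a + p) + γ * y ^ (a + p + n) = α * y ^ (a + p) * ψ y := by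
    intro y hy
    have e1 : y ^ (a + p) * y ^ (-(p : ℤ)) = y ^ a := by
      rw [← zpow_natCast, ← zpow_add₀ hy.ne', ← zpow_natCast]
      congr 1; push_cast; ring
    have e2 : y ^ (a + p) * y ^ (n : ℤ) = y ^ (a + p + n) := by
      rw [zpow_natCast, ← pow_add]
    rw [hψ]
    simp only [smul_eq_mul]
    have : α * y ^ (a + p) * (y ^ (-(p : ℤ)) + (γ / α * y ^ (n : ℤ) + β / α))
        = α * (y ^ (a + p) * y ^ (-(p : ℤ))) + γ * (y ^ (a + p) * y ^ (n : ℤ)) * (α / α)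
          + β * y ^ (a + p) * (α / α) := by ring
    rw [this, e1, e2, div_self hα.ne']; ring
  have hψle : ∀ y : ℝ, 0 < y → α * y ^ a + β * y ^ (a + p) + γ * y ^ (a + p + n) ≤ 0 → ψ y ≤ 0 := by
    intro y hy hq
    rw [hfac y hy] at hq
    have hpos : 0 < α * y ^ (a + p) := mul_pos hα (by positivity)
    by_contra hcon
    have := mul_pos hpos (not_le.mp hcon)
    linarith
  have hseg : x₂ ∈ openSegment ℝ x₁ x₃ := by
    rw [openSegment_eq_Ioo (h12.trans h23)]; exact ⟨h12, h23⟩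
  have hlt := hconv.lt_on_openSegment (mem_Ioi.mpr hx₁) (mem_Ioi.mpr hx₃) (h12.trans h23).ne hseg
  have hψ2 : ψ x₂ < 0 :=
    hlt.trans_le (max_le (hψle x₁ hx₁ hq1) (hψle x₃ hx₃ hq3))
  rw [hfac x₂ hx₂]
  exact mul_neg_of_pos_of_neg (mul_pos hα (by positivity)) hψ2

/-! ## The laws for three-letter pencils with a definite end letter (any size `m`, any sorted support) -/

/-- The quadratic form of an evaluated pencil is the power-weighted sum of the letters' quadratic forms. [folklore] -/
theorem quadForm_pencil_eval_any {K m : ℕ} (d : Fin K → ℕ) (S : Fin K → Matrix (Fin m) (Fin m) ℝ)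
    (u : Fin m → ℝ) (x : ℝ) :
    u ⬝ᵥ ((∑ l, x ^ d l • S l) *ᵥ u) = ∑ l, x ^ d l * (u ⬝ᵥ (S l *ᵥ u)) := by
  simp [Matrix.sum_mulVec, Matrix.smul_mulVec, dotProduct_sum, dotProduct_smul, smul_eq_mul]

/-- Three-letter case of `quadForm_pencil_eval_any`, written as a trinomial in `x`. [folklore] -/
theorem quadForm_pencil_eval_three {m : ℕ} (d : Fin 3 → ℕ) (S : Fin 3 → Matrix (Fin m) (Fin m) ℝ)
    (u : Fin m → ℝ) (x : ℝ) :
    u ⬝ᵥ ((∑ l, x ^ d l • S l) *ᵥ u)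
      = (u ⬝ᵥ (S 0 *ᵥ u)) * x ^ d 0 + (u ⬝ᵥ (S 1 *ᵥ u)) * x ^ d 1 + (u ⬝ᵥ (S 2 *ᵥ u)) * x ^ d 2 := by
  rw [quadForm_pencil_eval_any, Fin.sum_univ_three]; ring

/-- A sorted three-term support `d₀ < d₁ < d₂` as `d₁ = d₀ + p`, `d₂ = d₀ + p + n` with `p, n ≥ 1`. [folklore] -/
theorem sorted_support_three {d : Fin 3 → ℕ} (h01 : d 0 < d 1) (h12 : d 1 < d 2) :
    ∃ p n : ℕ, 0 < p ∧ 0 < n ∧ d 1 = d 0 + p ∧ d 2 = d 0 + p + n := by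
  refine ⟨d 1 - d 0, d 2 - d 1, by omega, by omega, by omega, by omega⟩

/-- **RAY LAW (definite bottom letter).**  Let `F(x) = Σ_l x^{d l} S_l` be a three-letter pencil on a sorted support
`d 0 < d 1 < d 2` (any size), `u` a direction with `uᵀ S₀ u > 0` (e.g. `S₀ ≻ 0`, `u ≠ 0`) and `uᵀ S₂ u ≤ 0`.  If
`uᵀ F(r) u ≤ 0` at some `r > 0` — in particular if `u` is a kernel vector of the det-root `r` — then `uᵀ F(x) u < 0` for
every `x > r`. [folklore] -/
theorem endLetter_ray_law {m : ℕ} (d : Fin 3 → ℕ) (h01 : d 0 < d 1) (h12 : d 1 < d 2)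
    (S : Fin 3 → Matrix (Fin m) (Fin m) ℝ) (u : Fin m → ℝ)
    (h0 : 0 < u ⬝ᵥ (S 0 *ᵥ u)) (h2 : u ⬝ᵥ (S 2 *ᵥ u) ≤ 0) {r x : ℝ} (hr : 0 < r) (hrx : r < x)
    (hqr : u ⬝ᵥ ((∑ l, r ^ d l • S l) *ᵥ u) ≤ 0) :
    u ⬝ᵥ ((∑ l, x ^ d l • S l) *ᵥ u) < 0 := by
  obtain ⟨p, n, hp, -, h1e, h2e⟩ := sorted_support_three h01 h12
  rw [quadForm_pencil_eval_three] at hqr ⊢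
  rw [h1e, h2e] at hqr ⊢
  have := trinomial_ray_law (a := d 0) (β := u ⬝ᵥ (S 1 *ᵥ u)) hp h0 h2 hr hrx (by linarith)
  linarith

/-- **No positive semidefinite point beyond such a root.**  Under the hypotheses of `endLetter_ray_law`, `F(x)` is positive
semidefinite at NO `x > r`; so on a definite-bottom-letter row the det-roots at which `F` is positive semidefinite and some
kernel vector has `uᵀ S₂ u ≤ 0` number at most one (the last), and no positive definite point lies beyond it. [folklore] -/
theorem endLetter_not_posSemidef_beyond {m : ℕ} (d : Fin 3 → ℕ) (h01 : d 0 < d 1) (h12 : d 1 < d 2)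
    (S : Fin 3 → Matrix (Fin m) (Fin m) ℝ) (u : Fin m → ℝ)
    (h0 : 0 < u ⬝ᵥ (S 0 *ᵥ u)) (h2 : u ⬝ᵥ (S 2 *ᵥ u) ≤ 0) {r x : ℝ} (hr : 0 < r) (hrx : r < x)
    (hqr : u ⬝ᵥ ((∑ l, r ^ d l • S l) *ᵥ u) ≤ 0) :
    ¬ (∑ l, x ^ d l • S l).PosSemidef := by
  intro hpsd
  have h := hpsd.dotProduct_mulVec_nonneg u
  rw [star_trivial] at h
  exact absurd (endLetter_ray_law d h01 h12 S u h0 h2 hr hrx hqr) (not_lt.mpr h)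

/-- **RAY LAW BELOW (definite top letter).**  Mirror of `endLetter_ray_law`: `uᵀ S₂ u > 0`, `uᵀ S₀ u ≤ 0` and
`uᵀ F(r) u ≤ 0` at `r > 0` force `uᵀ F(x) u < 0` for every `0 < x < r`. [folklore] -/
theorem endLetter_ray_law_below {m : ℕ} (d : Fin 3 → ℕ) (h01 : d 0 < d 1) (h12 : d 1 < d 2)
    (S : Fin 3 → Matrix (Fin m) (Fin m) ℝ) (u : Fin m → ℝ)
    (h0 : u ⬝ᵥ (S 0 *ᵥ u) ≤ 0) (h2 : 0 < u ⬝ᵥ (S 2 *ᵥ u)) {r x : ℝ} (hx : 0 < x) (hxr : x < r)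
    (hqr : u ⬝ᵥ ((∑ l, r ^ d l • S l) *ᵥ u) ≤ 0) :
    u ⬝ᵥ ((∑ l, x ^ d l • S l) *ᵥ u) < 0 := by
  obtain ⟨p, n, -, hn, h1e, h2e⟩ := sorted_support_three h01 h12
  rw [quadForm_pencil_eval_three] at hqr ⊢
  rw [h1e, h2e] at hqr ⊢
  have := trinomial_ray_law_below (a := d 0) (p := p) (β := u ⬝ᵥ (S 1 *ᵥ u)) hn h0 h2 hx hxr (by linarith)
  linarith

/-- **INTERVAL LAW (definite bottom letter).**  Let `F(x) = Σ_l x^{d l} S_l` be a three-letter pencil on a sorted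
support (any size) and `u` a direction with `uᵀ S₀ u > 0`.  If `uᵀ F(x₁) u ≤ 0` and `uᵀ F(x₃) u ≤ 0` with `0 < x₁ < x₃`,
then `uᵀ F(x₂) u < 0` for every `x₂ ∈ (x₁, x₃)`: the non-positivity set of a fixed direction is an interval. [folklore] -/
theorem endLetter_interval_law {m : ℕ} (d : Fin 3 → ℕ) (h01 : d 0 < d 1) (h12 : d 1 < d 2)
    (S : Fin 3 → Matrix (Fin m) (Fin m) ℝ) (u : Fin m → ℝ) (h0 : 0 < u ⬝ᵥ (S 0 *ᵥ u))
    {x₁ x₂ x₃ : ℝ} (hx₁ : 0 < x₁) (h12x : x₁ < x₂) (h23x : x₂ < x₃)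
    (hq1 : u ⬝ᵥ ((∑ l, x₁ ^ d l • S l) *ᵥ u) ≤ 0) (hq3 : u ⬝ᵥ ((∑ l, x₃ ^ d l • S l) *ᵥ u) ≤ 0) :
    u ⬝ᵥ ((∑ l, x₂ ^ d l • S l) *ᵥ u) < 0 := by
  obtain ⟨p, n, hp, -, h1e, h2e⟩ := sorted_support_three h01 h12
  rw [quadForm_pencil_eval_three] at hq1 hq3 ⊢
  rw [h1e, h2e] at hq1 hq3 ⊢
  have := trinomial_interval_law (a := d 0) (n := n) (β := u ⬝ᵥ (S 1 *ᵥ u)) (γ := u ⬝ᵥ (S 2 *ᵥ u))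
    hp h0 hx₁ h12x h23x (by linarith) (by linarith)
  linarith

/-- **One direction never witnesses two gaps.**  With `uᵀ S₀ u > 0`: if `uᵀ F(x₁) u ≤ 0` and `uᵀ F(x₃) u ≤ 0`
(`0 < x₁ < x₃`), then `F` is positive semidefinite at NO point of `(x₁, x₃)` — two non-definite gaps of a
definite-bottom-letter row separated by a positive (semi)definite point are never witnessed by the same direction. [folklore] -/
theorem endLetter_not_posSemidef_between {m : ℕ} (d : Fin 3 → ℕ) (h01 : d 0 < d 1) (h12 : d 1 < d 2)
    (S : Fin 3 → Matrix (Fin m) (Fin m) ℝ) (u : Fin m → ℝ) (h0 : 0 < u ⬝ᵥ (S 0 *ᵥ u))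
    {x₁ x₂ x₃ : ℝ} (hx₁ : 0 < x₁) (h12x : x₁ < x₂) (h23x : x₂ < x₃)
    (hq1 : u ⬝ᵥ ((∑ l, x₁ ^ d l • S l) *ᵥ u) ≤ 0) (hq3 : u ⬝ᵥ ((∑ l, x₃ ^ d l • S l) *ᵥ u) ≤ 0) :
    ¬ (∑ l, x₂ ^ d l • S l).PosSemidef := by
  intro hpsd
  have h := hpsd.dotProduct_mulVec_nonneg u
  rw [star_trivial] at h
  exact absurd (endLetter_interval_law d h01 h12 S u h0 hx₁ h12x h23x hq1 hq3) (not_lt.mpr h)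

/-- **Kernel vectors are positive beyond the next definite point.**  With `uᵀ S₀ u > 0`: if `uᵀ F(r) u ≤ 0` (e.g. `u` a
kernel vector of the det-root `r > 0`) and `F(p)` is positive semidefinite at some `p > r`, then `uᵀ F(x) u > 0` at every
`x > p` — in a `λ₁`-oscillating definite-bottom-letter row the kernel line of each root is strictly positive at all roots
past the next positive definite interval, so the negative cones of distinct gaps are disjoint. [folklore] -/
theorem endLetter_kernel_pos_beyond_gap {m : ℕ} (d : Fin 3 → ℕ) (h01 : d 0 < d 1) (h12 : d 1 < d 2)
    (S : Fin 3 → Matrix (Fin m) (Fin m) ℝ) (u : Fin m → ℝ) (h0 : 0 < u ⬝ᵥ (S 0 *ᵥ u))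
    {r p x : ℝ} (hr : 0 < r) (hrp : r < p) (hpx : p < x)
    (hqr : u ⬝ᵥ ((∑ l, r ^ d l • S l) *ᵥ u) ≤ 0) (hp : (∑ l, p ^ d l • S l).PosSemidef) :
    0 < u ⬝ᵥ ((∑ l, x ^ d l • S l) *ᵥ u) := by
  by_contra hcon
  exact endLetter_not_posSemidef_between d h01 h12 S u h0 hr hrp hpx hqr (not_lt.mp hcon) hp

end Summit.ValiantsHypothesis.ValiantsHypothesis.Theorems.LacunarySymmetroidMatrixDescartes.Census
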